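import Literature.Probability.RandomPlanarGeometry.SLERestrictionConvergence
import Literature.Probability.RandomPlanarGeometry.SLERestrictionSlidHull
import Literature.Probability.RandomPlanarGeometry.SLERestrictionSimple
import Literature.Probability.RandomPlanarGeometry.SLEBoundaryHittingProofs
import Literature.Probability.RandomPlanarGeometry.SLERestrictionSmoothProofs
import Literature.Probability.RandomPlanarGeometry.RohdeSchrammCor35Proofs
import HarnessLib

/-!
# The restriction martingale of [LSW] Prop. 5.2/5.3 (`κ = 8/3`) exists

We discharge the named fact `sle_exists_isRestrictionMartingale` ([LSW] Prop. 5.2 with Prop. 5.3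
at `κ = 8/3`, plus the martingale convergence step of the proof of Thm. 6.1) from the
Rohde–Schramm trace facts (the SLE_{8/3} chain is a.s. generated by a simple curve):

* pathwise structure of the limit process `Ȳ` of `SLERestrictionConvergence`
  (`Ybar_eq_Yproc_of_disjoint`: `Ȳ_t = Φ'_{A_t - W_t}(0)^{5/8}` while the hulls have not reached
  `A`; `exists_frozen_of_cauchy`: on the a.s. Cauchy event `Ȳ` is frozen at the terminal time,
  equal there to its left limit, and convergent at `∞` if `A` is never reached);
* `disjoint_closedHull_iff_lt_firstHit` — for a chain generated by a simple curve, the hulls have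
  not reached `A` at time `t` iff `t` is before the first hitting time of `A` by the curve;
* `isRestrictionMartingale_Ybar`, `sle_exists_isRestrictionMartingale_of_trace_facts` — the fact,
  from `hasSLETrace_of_ne_eight` and `ae_isSimpleTrace_sleTrace_of_le_four`;
* `IsSLELaw.hullRestriction_eightThirds_of_trace_facts` — consequently **[LSW] Thm. 6.1**
  (`hullRestriction_eightThirds`) follows from the three Rohde–Schramm trace facts alone
  (`IsSLELaw.hullRestriction_eightThirds_of_leaf_facts''` with
  `IsSmoothHull.restrictionDerivVanishesAtHit_holds`).

## References

* G. F. Lawler, O. Schramm, W. Werner, *Conformal restriction: the chordal case* (2003),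
  Prop. 5.2, Prop. 5.3, proof of Thm. 6.1 [LawlerSchrammWerner2003Restriction].
* S. Rohde, O. Schramm, *Basic properties of SLE* (2005), Thm 5.1, Thm 6.1 [RohdeSchramm2005].
-/

noncomputable section

open Set Filter Metric Function MeasureTheory ProbabilityTheory
open _root_.Complex _root_.Topology
open Literature.Probability.Process (brownian preWienerMeasure)
open scoped NNReal

namespace Literature.Probability.RandomPlanarGeometry

open Loewner PathOps

section Pathwise

variable {A : Set ℂ} {hA : IsStarHull A} {hne : A.Nonempty} {k₀ : ℕ}

/-- Stopped values: `Y^{T}_t = Y_t` for `t < T`. [folklore] -/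
theorem stoppedProcess_apply_of_lt {T : (ℝ≥0 → ℝ) → WithTop ℝ≥0} {t : ℝ≥0} {ω : ℝ≥0 → ℝ}
    (ht : (t : WithTop ℝ≥0) < T ω) : stoppedProcess (Yproc A) T t ω = Yproc A t ω := by
  rw [stoppedProcess, min_eq_left ht.le, Process.untopA_coe]

/-- Stopped values after the (finite) stopping time: `Y^{T}_t = Y_T` for `T ≤ t`. [folklore] -/
theorem stoppedProcess_apply_of_le {T : (ℝ≥0 → ℝ) → WithTop ℝ≥0} {t τ : ℝ≥0} {ω : ℝ≥0 → ℝ}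
    (hT : T ω = τ) (ht : τ ≤ t) : stoppedProcess (Yproc A) T t ω = Yproc A τ ω := by
  rw [stoppedProcess, hT, min_eq_right (WithTop.coe_le_coe.2 ht), Process.untopA_coe]

/-- **While alive, `Ȳ_t = Y_t`** (the localised martingales are eventually constant in `k`).
[folklore] -/
theorem Ybar_eq_Yproc_of_disjoint (hk₀ : ∀ k, k₀ ≤ k → ∀ ω, (0 : WithTop ℝ≥0) < locTime hA hne k ω)
    {t : ℝ≥0} {ω : ℝ≥0 → ℝ} (halive : Disjoint (closedHull (drv (brownianCPath ω)) t) A) :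
    Ybar hA hne k₀ t ω = Yproc A t ω := by
  obtain ⟨k, hk⟩ := (disjoint_closedHull_iff_exists_lt_locTime (hA := hA) (hne := hne) t ω).1 halive
  have hev : ∀ᶠ j in atTop, locMart hA hne (j + k₀) t ω = Yproc A t ω := by
    filter_upwards [eventually_ge_atTop k] with j hj
    have hlt : (t : WithTop ℝ≥0) < locTime hA hne (j + k₀) ω := hk.trans_le (monotone_locTime ω (by omega))
    rw [← stoppedProcess_Yproc_eq_locMart (hk₀ _ le_add_self), stoppedProcess_apply_of_lt hlt]
  rw [Ybar]
  exact (tendsto_const_nhds.congr' (EventuallyEq.symm hev)).limsup_eq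

/-- A dead time bounds every localising time. [folklore] -/
theorem locTime_le_of_not_disjoint {t : ℝ≥0} {ω : ℝ≥0 → ℝ} (hdead : ¬ Disjoint (closedHull (drv (brownianCPath ω)) t) A)
    (k : ℕ) : locTime hA hne k ω ≤ (t : WithTop ℝ≥0) := by
  by_contra h
  exact hdead (controlled_of_lt_locTime (not_le.1 h)).1

/-- **On the a.s. Cauchy event, `Ȳ` is frozen at the terminal time**: there is `L` with `Ȳ_t = L`
at every dead time `t`, `Ȳ_s → L` as `s ↗ τ` at the first dead time `τ`, and — if no time is
dead — `Ȳ_t` converges as `t → ∞`. [cite: LawlerSchrammWerner2003Restriction, proof of Thm. 6.1] -/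
theorem exists_frozen_of_cauchy (hk₀ : ∀ k, k₀ ≤ k → ∀ ω, (0 : WithTop ℝ≥0) < locTime hA hne k ω) {ω : ℝ≥0 → ℝ}
    (hω : ∀ ε : ℝ, 0 < ε → ∃ K : ℕ, ∀ k, K ≤ k → ∀ J, k ≤ J → ∀ r : ℝ≥0,
      |stoppedProcess (Yproc A) (locTime hA hne (J + k₀)) r ω - stoppedProcess (Yproc A) (locTime hA hne (k + k₀)) r ω| ≤ ε) :
    (∀ τ : ℝ≥0, (∀ s, s < τ → Disjoint (closedHull (drv (brownianCPath ω)) s) A) →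
        ¬ Disjoint (closedHull (drv (brownianCPath ω)) τ) A →
        ∃ L : ℝ, (∀ t, τ ≤ t → Ybar hA hne k₀ t ω = L) ∧ Tendsto (fun s ↦ Ybar hA hne k₀ s ω) (𝓝[<] τ) (𝓝 L)) ∧
      ((∀ t, Disjoint (closedHull (drv (brownianCPath ω)) t) A) → ∃ c : ℝ, Tendsto (fun t ↦ Ybar hA hne k₀ t ω) atTop (𝓝 c)) := by
  have hpos : ∀ k, (0 : WithTop ℝ≥0) < locTime hA hne (k + k₀) ω := fun k ↦ hk₀ _ le_add_self ω
  -- the localising times as finite alive times `σ k`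
  have hfin : ∀ k, locTime hA hne (k + k₀) ω ≠ ⊤ := fun k ↦
    ne_top_of_le_ne_top WithTop.coe_ne_top (locTime_le (k + k₀) ω)
  set σ : ℕ → ℝ≥0 := fun k ↦ (locTime hA hne (k + k₀) ω).untop (hfin k) with hσ
  have hσeq : ∀ k, locTime hA hne (k + k₀) ω = σ k := fun k ↦ (WithTop.coe_untop _ (hfin k)).symm
  have hσalive : ∀ k, Disjoint (closedHull (drv (brownianCPath ω)) (σ k)) A := fun k ↦
    (controlled_of_le_locTime (t := σ k) (by rw [hσeq]) (hpos k)).1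
  -- the frozen values `y k = Y_{σ k}` and their limit
  set y : ℕ → ℝ := fun k ↦ Yproc A (σ k) ω with hy
  have hstop_ge : ∀ k (r : ℝ≥0), σ k ≤ r → stoppedProcess (Yproc A) (locTime hA hne (k + k₀)) r ω = y k := fun k r hr ↦
    stoppedProcess_apply_of_le (hσeq k) hr
  have hycauchy : ∀ ε : ℝ, 0 < ε → ∃ K, ∀ k, K ≤ k → ∀ J, k ≤ J → |y J - y k| ≤ ε := by
    intro ε hε
    obtain ⟨K, hK⟩ := hω ε hε
    refine ⟨K, fun k hk J hJ ↦ ?_⟩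
    have hmono : σ k ≤ σ J := by
      have h1 : locTime hA hne (k + k₀) ω ≤ locTime hA hne (J + k₀) ω := monotone_locTime ω (show k + k₀ ≤ J + k₀ by omega)
      rw [hσeq, hσeq] at h1; exact_mod_cast h1
    have := hK k hk J hJ (σ J)
    rwa [hstop_ge J (σ J) le_rfl, hstop_ge k (σ J) hmono] at this
  obtain ⟨L, hL⟩ : ∃ L, Tendsto y atTop (𝓝 L) := by
    refine cauchySeq_tendsto_of_complete (Metric.cauchySeq_iff'.2 fun ε hε ↦ ?_)
    obtain ⟨K, hK⟩ := hycauchy (ε / 2) (by positivity)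
    exact ⟨K, fun J hJ ↦ by rw [Real.dist_eq]; exact lt_of_le_of_lt (hK K le_rfl J hJ) (by linarith)⟩
  have hLy : ∀ ε : ℝ, 0 < ε → ∃ K, ∀ k, K ≤ k → |L - y k| ≤ ε := fun ε hε ↦ by
    obtain ⟨K, hK⟩ := hycauchy ε hε
    refine ⟨K, fun k hk ↦ ?_⟩
    have : Tendsto (fun J ↦ |y J - y k|) atTop (𝓝 |L - y k|) := ((hL.sub tendsto_const_nhds).abs)
    exact le_of_tendsto this (eventually_atTop.2 ⟨k, fun J hJ ↦ hK k hk J hJ⟩)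
  constructor
  · -- the first dead time `τ`
    intro τ hbefore hdead
    have hσlt : ∀ k, σ k < τ := fun k ↦ by
      have h1 : ((σ k : ℝ≥0) : WithTop ℝ≥0) ≤ τ := by rw [← hσeq]; exact locTime_le_of_not_disjoint hdead _
      rcases (WithTop.coe_le_coe.1 h1).eq_or_lt with h | h
      · exact absurd (h ▸ hσalive k) hdead
      · exact h
    -- `Ȳ = L` at dead times
    have hdeadval : ∀ t, τ ≤ t → Ybar hA hne k₀ t ω = L := by
      intro t ht
      have hdt : ¬ Disjoint (closedHull (drv (brownianCPath ω)) t) A := fun h ↦ hdead (alive_mono ht h)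
      have hev : ∀ k, locMart hA hne (k + k₀) t ω = y k := fun k ↦ by
        rw [← stoppedProcess_Yproc_eq_locMart (hk₀ (k + k₀) le_add_self)]
        exact hstop_ge k t ((hσlt k).le.trans ht)
      rw [Ybar]; simp_rw [hev]
      exact hL.limsup_eq
    refine ⟨L, hdeadval, ?_⟩
    rw [Metric.tendsto_nhdsWithin_nhds]
    intro ε hε
    obtain ⟨K, hK⟩ := hω (ε / 3) (by positivity)
    obtain ⟨K', hK'⟩ := hLy (ε / 3) (by positivity)
    set k := max K K' with hk
    have hσk : (σ k : ℝ) < τ := by exact_mod_cast hσlt k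
    refine ⟨(τ : ℝ) - σ k, by linarith, fun s hs hds ↦ ?_⟩
    have hsτ : s < τ := hs
    have hsτ' : (s : ℝ) ≤ τ := by exact_mod_cast hsτ.le
    have hσs : σ k ≤ s := by
      rw [NNReal.dist_eq, abs_sub_comm, abs_of_nonneg (by linarith)] at hds
      have : (σ k : ℝ) ≤ s := by linarith
      exact_mod_cast this
    have halive := hbefore s hsτ
    -- a later localising time beyond `s`
    obtain ⟨j, hj⟩ := (disjoint_closedHull_iff_exists_lt_locTime (hA := hA) (hne := hne) s ω).1 halive
    set J := max j k with hJ
    have hJs : (s : WithTop ℝ≥0) < locTime hA hne (J + k₀) ω := hj.trans_le (monotone_locTime ω (by omega))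
    have h1 := hK k (le_max_left _ _) J (le_max_right _ _) s
    rw [stoppedProcess_apply_of_lt hJs, hstop_ge k s hσs] at h1
    have h2 := hK' k (le_max_right _ _)
    rw [Real.dist_eq, Ybar_eq_Yproc_of_disjoint hk₀ halive]
    have : |Yproc A s ω - L| ≤ |Yproc A s ω - y k| + |L - y k| := by
      have := abs_sub_le (Yproc A s ω) (y k) L
      rw [abs_sub_comm (y k) L] at this; exact this
    linarith
  · -- never dead: `Ȳ = Y` converges at infinity
    intro hall
    refine ⟨L, Metric.tendsto_atTop.2 fun ε hε ↦ ?_⟩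
    obtain ⟨K, hK⟩ := hω (ε / 3) (by positivity)
    obtain ⟨K', hK'⟩ := hLy (ε / 3) (by positivity)
    set k := max K K' with hk
    refine ⟨σ k, fun r hr ↦ ?_⟩
    obtain ⟨j, hj⟩ := (disjoint_closedHull_iff_exists_lt_locTime (hA := hA) (hne := hne) r ω).1 (hall r)
    set J := max j k with hJ
    have hJr : (r : WithTop ℝ≥0) < locTime hA hne (J + k₀) ω := hj.trans_le (monotone_locTime ω (by omega))
    have h1 := hK k (le_max_left _ _) J (le_max_right _ _) r
    rw [stoppedProcess_apply_of_lt hJr, hstop_ge k r hr] at h1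
    have h2 := hK' k (le_max_right _ _)
    rw [Real.dist_eq, Ybar_eq_Yproc_of_disjoint hk₀ (hall r)]
    have : |Yproc A r ω - L| ≤ |Yproc A r ω - y k| + |L - y k| := by
      have := abs_sub_le (Yproc A r ω) (y k) L
      rw [abs_sub_comm (y k) L] at this; exact this
    linarith

end Pathwise

/-! ### Hulls generated by a simple curve reach `A` exactly when the curve hits `A` -/

/-- For a chain driven by `W` with `W 0 = 0`, generated by a simple curve `γ`, and a `*`-hull `A`:
the closed hulls miss `A` at time `t` iff `t` is before the first hitting time of `A` by `γ`.
[cite: LawlerSchrammWerner2003Restriction, §5 (T) and proof of Thm. 6.1] -/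
theorem disjoint_closedHull_iff_lt_firstHit {W : ℝ≥0 → ℝ} {γ : ℝ≥0 → ℂ} {A : Set ℂ} (hW : Continuous W) (hW0 : W 0 = 0)
    (hγ : IsGeneratedByCurve W γ) (hs : IsSimpleTrace γ) (hA : IsStarHull A) (t : ℝ≥0) :
    Disjoint (closedHull W t) A ↔ (t : WithTop ℝ≥0) < firstHit γ A := by
  constructor
  · intro halive
    by_contra hle
    rw [not_lt] at hle
    obtain ⟨t₀, ht₀, hγt₀⟩ := exists_firstHit_eq_coe hγ.1 hA.isBoundedHull.isCompact.isClosed (ne_top_of_le_ne_top WithTop.coe_ne_top hle)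
    have ht₀t : t₀ ≤ t := by rw [ht₀] at hle; exact_mod_cast hle
    have ht₀pos : 0 < t₀ := by
      rcases (zero_le (α := ℝ≥0) (a := t₀)).eq_or_lt with h | h
      · rw [← h, hγ.2.1, hW0, Complex.ofReal_zero] at hγt₀
        exact absurd hγt₀ hA.zero_notMem
      · exact h
    have him : 0 < (γ t₀).im := hs.2 t₀ ht₀pos
    have hhull : γ t₀ ∈ hull W t₀ := hγ.mem_hull_of_mem_image him ⟨t₀, ⟨bot_le, le_rfl⟩, rfl⟩
    have hcl : γ t₀ ∈ closedHull W t := closedHull_mono W ht₀t (mem_closedHull_iff.2 (Or.inl hhull))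
    exact Set.disjoint_left.1 halive hcl hγt₀
  · intro hlt
    have hdisj := image_Icc_disjoint_of_lt_firstHit hlt
    rw [Set.disjoint_left]
    rintro z ⟨-, hzT⟩ hzA
    exact absurd (hγ.lt_swallowingTime_of_disjoint hW hs hA.isBoundedHull hdisj hzA) (not_lt.2 hzT)

/-! ### The restriction martingale exists -/

/-- **[LSW] Prop. 5.2/5.3 (`κ = 8/3`): the restriction martingale of a nonempty `*`-hull**, from the
Rohde–Schramm trace facts. [cite: LawlerSchrammWerner2003Restriction, Prop. 5.2 and Prop. 5.3] -/
theorem isRestrictionMartingale_Ybar {A : Set ℂ} (hA : IsStarHull A) (hne : A.Nonempty) {k₀ : ℕ}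
    (hk₀ : ∀ k, k₀ ≤ k → ∀ ω, (0 : WithTop ℝ≥0) < locTime hA hne k ω)
    (hgen : HasSLETrace ((8 : ℝ≥0) / 3))
    (hsimple : ∀ᵐ ω ∂preWienerMeasure, IsSimpleTrace (sleTrace ((8 : ℝ≥0) / 3) ω)) :
    IsRestrictionMartingale A (Ybar hA hne k₀) := by
  have hdrv : ∀ ω, drv (brownianCPath ω) = sleDriving ((8 : ℝ≥0) / 3) ω := fun ω ↦ drv_brownianCPath ω
  have hident : ∀ᵐ ω ∂preWienerMeasure, ∀ t, Disjoint (closedHull (drv (brownianCPath ω)) t) A ↔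
      (t : WithTop ℝ≥0) < firstHit (sleTrace ((8 : ℝ≥0) / 3) ω) A := by
    filter_upwards [ae_isGeneratedByCurve_sleTrace hgen, hsimple] with ω hg hs t
    rw [hdrv]
    exact disjoint_closedHull_iff_lt_firstHit (continuous_sleDriving _ ω) (sleDriving_zero _ ω) hg hs hA t
  refine ⟨fun t ω ↦ Ybar_mem_Icc k₀ t ω, martingale_Ybar hk₀, ?_, ?_, ?_⟩
  · filter_upwards [hident] with ω hω t ht
    have halive := (hω t).2 ht
    have hB : IsStarHull (slidHull (sleDriving ((8 : ℝ≥0) / 3) ω) A t) := by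
      rw [← hdrv]; exact isStarHull_slidHull_of_disjoint (continuous_drv _) hA halive
    obtain ⟨hd0, hd1, hd⟩ := starDeriv_spec hB
    refine ⟨starRMap _ hB, starDeriv (slidHull (sleDriving ((8 : ℝ≥0) / 3) ω) A t), isRestrictionMap_starRMap hB, hd, hd0, hd1, ?_⟩
    rw [Ybar_eq_Yproc_of_disjoint hk₀ halive, Yproc, (DFn_eq (A := A) t (brownianCPath ω)).1 halive, hdrv]
  · filter_upwards [hident, ae_cauchy_stoppedProcess_Yproc hk₀] with ω hω hcauchy τ hτ t hτt
    have hbefore : ∀ s, s < τ → Disjoint (closedHull (drv (brownianCPath ω)) s) A := fun s hs ↦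
      (hω s).2 (by rw [hτ]; exact_mod_cast hs)
    have hdead : ¬ Disjoint (closedHull (drv (brownianCPath ω)) τ) A := fun h ↦ by
      have := (hω τ).1 h; rw [hτ] at this; exact lt_irrefl _ this
    obtain ⟨L, hL, hlim⟩ := (exists_frozen_of_cauchy hk₀ hcauchy).1 τ hbefore hdead
    rw [hL t hτt]; exact hlim
  · filter_upwards [hident, ae_cauchy_stoppedProcess_Yproc hk₀] with ω hω hcauchy htop
    exact (exists_frozen_of_cauchy hk₀ hcauchy).2 fun t ↦ (hω t).2 (by rw [htop]; exact WithTop.coe_lt_top t)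

/-- **DISCHARGE (from the trace facts) of `sle_exists_isRestrictionMartingale`** — [LSW] Prop. 5.2
with Prop. 5.3 at `κ = 8/3` and the martingale convergence step of the proof of Thm. 6.1: for every
`A ∈ 𝒬*` there is a process satisfying `IsRestrictionMartingale A`, granted that the SLE_{8/3}
chain is a.s. generated by a simple curve (Rohde–Schramm).
[cite: LawlerSchrammWerner2003Restriction, Prop. 5.2, Prop. 5.3 and proof of Thm. 6.1] -/
theorem sle_exists_isRestrictionMartingale_of_trace_facts (hne8 : hasSLETrace_of_ne_eight)
    (h₆ : ae_isSimpleTrace_sleTrace_of_le_four (κ := (8 : ℝ≥0) / 3)) : sle_exists_isRestrictionMartingale := by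
  intro A hA
  haveI : Fact Process.isProjectiveLimit_preWienerMeasure := ⟨isProjectiveLimit_preWienerMeasure_holds⟩
  rcases A.eq_empty_or_nonempty with rfl | hne
  · exact ⟨fun _ _ ↦ 1, isRestrictionMartingale_empty⟩
  · obtain ⟨k₀, hk₀⟩ := exists_forall_locTime_pos hA hne
    exact ⟨Ybar hA hne k₀, isRestrictionMartingale_Ybar hA hne hk₀ (hne8 (by norm_num))
      (h₆ (by positivity) (by rw [div_le_iff₀ (by norm_num : (0 : ℝ≥0) < 3)]; norm_num))⟩

/-- **[LSW] Thm. 6.1 from the Rohde–Schramm trace facts alone**: SLE_{8/3} satisfies the hull form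
of the restriction identity `P[γ ∩ A = ∅] = Φ'_A(0)^{5/8}` for smooth `*`-hulls, granted existence,
transience and simplicity of the SLE_{8/3} trace (`hasSLETrace_of_ne_eight`,
`tendsto_norm_sleTrace_atTop`, `ae_isSimpleTrace_sleTrace_of_le_four`; the restriction martingale is
`sle_exists_isRestrictionMartingale_of_trace_facts`, Lemma 6.3 is
`IsSmoothHull.restrictionDerivVanishesAtHit_holds`). [cite: LawlerSchrammWerner2003Restriction, Thm. 6.1] -/
theorem IsSLELaw.hullRestriction_eightThirds_of_trace_facts (hne8 : hasSLETrace_of_ne_eight)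
    (htr : tendsto_norm_sleTrace_atTop) (h₆ : ae_isSimpleTrace_sleTrace_of_le_four (κ := (8 : ℝ≥0) / 3)) :
    IsSLELaw.hullRestriction_eightThirds :=
  IsSLELaw.hullRestriction_eightThirds_of_leaf_facts'' hne8 htr h₆
    (sle_exists_isRestrictionMartingale_of_trace_facts hne8 h₆) IsSmoothHull.restrictionDerivVanishesAtHit_holds

/-- **[LSW] Thm. 6.1 from Rohde–Schramm Thm 6.1 (simplicity, `κ ≤ 4`) and Thm 7.1 (transience)
alone**: existence of the trace (Rohde–Schramm Thm 5.1) is `hasSLETrace_of_ne_eight_holds` in the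
tree, so the hull form of the restriction identity for SLE_{8/3} is reduced to the two remaining
Rohde–Schramm facts `ae_isSimpleTrace_sleTrace_of_le_four (κ := 8/3)` and
`tendsto_norm_sleTrace_atTop`. [cite: LawlerSchrammWerner2003Restriction, Thm. 6.1] -/
theorem IsSLELaw.hullRestriction_eightThirds_of_simple_of_transient (htr : tendsto_norm_sleTrace_atTop)
    (h₆ : ae_isSimpleTrace_sleTrace_of_le_four (κ := (8 : ℝ≥0) / 3)) : IsSLELaw.hullRestriction_eightThirds :=
  IsSLELaw.hullRestriction_eightThirds_of_trace_facts hasSLETrace_of_ne_eight_holds htr h₆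

end Literature.Probability.RandomPlanarGeometry
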